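import Mathlib
import HarnessLib
import Summits.HubbardSuperconductivity.HubbardSuperconductivity.Theorems.KLProgrammeKLRegimeEngineScaleZeroV17FG7Q7U9
import Summits.HubbardSuperconductivity.HubbardSuperconductivity.Theorems.KLProgrammeKLRegimeEngineV8DefsU10
import Summits.HubbardSuperconductivity.HubbardSuperconductivity.Theorems.KLProgrammeKLRegimeEngineV8DefsL4

/-!
# Stub (a) `stub_engine_scale0` of the K3 ENGINE-FLOW child at the v2 token set
# (#13 `klEngQ8`, #14 `klEngU₀10`, #15 `klEngGeo8`, #16 `klEngL₄ P R`; plan g17 (R47n), (R50) «AT v2 the registrant folds it in»)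

Cell `gate-hubbard-kl`, seat hubbard-kl-k3c2-p1 g5 (row «scale-0 Gram step `stub_engine_scale0`»).  The v1 closer `stub_engine_scale0_klEng7Q7U9`
(p538155; type = the v1 registered bytes f8654925… of stub (a)) lifted along the four v2 tokens, each by ONE monotone line ((R47n) table):
* #13 `klEngQ7 ↦ klEngQ8 := (klEngQ7 P R).withCR (max … (klE5Raise P R))` — conclusion-side: `scaleZeroConjV17F2_mono_Q` with `CE`, `cE4` equal by `rfl`
  and `klEngQ7_CR_le_klEngQ8_CR` ((E2-F2)₀ / (E2′-F UV)₀ read `CR` through `legDressBarQ2 … 0 4` only);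
* #15 `klEngGeo7 ↦ klEngGeo8 := klEngGeo7.raiseE4 klE4TF` — (E2-F2)₀, (E2′-F UV)₀, (E5-F)₀ `Iff.rfl` (`…_klEngGeo8_iff`), (E4)₀ monotone in `cE4`
  (`engineFirstMoments_klEngGeo8_of_klEngGeo7`); (E1-v4)₀ does not read `G`;
* #14 `klEngU₀9 ↦ klEngU₀10` — hypothesis-side: `hU₉ := hU.trans (klEngU₀10_le_klEngU₀9 P R c)`;
* #16 `klEngL₃ ↦ klEngL₄ P R` — hypothesis-side: `hL₃ := klEngL₃_le_of_klEngL₄_le hL`.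

* `scaleZeroConjV17F2_klEng8Q8_of_klEng7Q7` — the five-clause conclusion of stub (a) transported `(klEngGeo7, klEngQ7 P R) → (klEngGeo8, klEngQ8 P R)`;
* `stub_engine_scale0_klEng8Q8` — stub (a) at `(klEngGeo8, klEngQ8 P R)` under the v1 binders (`klEngU₀9`, `klEngL₃`);
* **`stub_engine_scale0_klEng8Q8U10L4`** — stub (a) at the v2 token set: THE PREDICTED v2 TEXT (v1 registered bytes with #13–#16 substituted verbatim:
  `klEngQ7 ↦ klEngQ8`, `klEngU₀9 ↦ klEngU₀10`, `klEngGeo7 ↦ klEngGeo8`, `klEngL₃ β U ↦ klEngL₄ P R β U`; `klEngC₃6`, `klEngM₃` unchanged), UNCONDITIONAL.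
  If the registrant's v2 render differs in bytes, the by-name re-closer is one `exact` away (v2-DAY PROTOCOL, (R47n) (2)(i)).

Bookkeeping only; nothing about the model is asserted beyond the cited upstream theorems; nothing asserts superconductivity.
-/

noncomputable section

namespace Summit.HubbardSuperconductivity.HubbardSuperconductivity.Theorems.EngineV8

set_option linter.dupNamespace false -- summit = problem name (single-conjunct summit), D-0017

open Real Finset Literature.MathematicalPhysics.QuantumLattice Literature.Probability.LatticeModels
open Summit.HubbardSuperconductivity.HubbardSuperconductivity.Theorems.KLRegimeSplit
open Summit.HubbardSuperconductivity.HubbardSuperconductivity.Theorems.KLProgrammeLegKernels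

section Transport

variable {L M : ℕ} [NeZero L] [NeZero M] {P : SplitConsts} {R : RenConsts} {β U μ : ℝ}

/-- **The five-clause conclusion of stub (a) transported `(klEngGeo7, klEngQ7 P R) → (klEngGeo8, klEngQ8 P R)`** (`P.WF`): tokens #13 (`CR`-raise:
`CE`, `cE4` by `rfl`, `CR` monotone) and #15 (`cE4`-raise of `G`: three clauses `Iff.rfl`, (E4)₀ monotone). -/
theorem scaleZeroConjV17F2_klEng8Q8_of_klEng7Q7 (hP : P.WF)
    (h : KernelNormsV4 L M P (klEngQ7 P R) β U μ (klFlowFrameU L M β U μ 0) 0 ∧ PairLadderStepAtV17F2 L M klEngGeo7 P (klEngQ7 P R) β U μ 0 ∧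
      QuarticValueUVAtV17F L M klEngGeo7 P (klEngQ7 P R) β U μ 0 ∧
        EngineFirstMoments L M klEngGeo7 P (klEngQ7 P R) β U μ (klFlowFrameU L M β U μ 0) 0 ∧ IsoTupleL1AtV17F L M klEngGeo7 P β U μ 0) :
    KernelNormsV4 L M P (klEngQ8 P R) β U μ (klFlowFrameU L M β U μ 0) 0 ∧ PairLadderStepAtV17F2 L M klEngGeo8 P (klEngQ8 P R) β U μ 0 ∧
      QuarticValueUVAtV17F L M klEngGeo8 P (klEngQ8 P R) β U μ 0 ∧
        EngineFirstMoments L M klEngGeo8 P (klEngQ8 P R) β U μ (klFlowFrameU L M β U μ 0) 0 ∧ IsoTupleL1AtV17F L M klEngGeo8 P β U μ 0 := by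
  have hK : 0 ≤ P.Klam := zero_le_one.trans hP.1
  -- token #13: `klEngQ7 → klEngQ8` at `G = klEngGeo7`
  obtain ⟨h1, h2, h3, h4, h5⟩ :=
    scaleZeroConjV17F2_mono_Q (Q := klEngQ7 P R) (Q' := klEngQ8 P R) (klEngQ7_wf P R).1 (klEngQ8_CE P R).ge
      (klEngQ7_CR_le_klEngQ8_CR P R) (klEngQ8_cE4 P R).ge hK h
  -- token #15: `klEngGeo7 → klEngGeo8`
  exact ⟨h1, pairLadderStepAtV17F2_klEngGeo8_iff.2 h2, quarticValueUVAtV17F_klEngGeo8_iff.2 h3,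
    engineFirstMoments_klEngGeo8_of_klEngGeo7 hK h4, isoTupleL1AtV17F_klEngGeo8_iff.2 h5⟩

end Transport

/-- **Stub (a) at `(klEngGeo8, klEngQ8 P R)` under the v1 binders** (`klEngC₃6`, `klEngU₀9`, `klEngL₃`, `klEngM₃`) — tokens #13 + #15 applied to
`stub_engine_scale0_klEng7Q7U9`. -/
theorem stub_engine_scale0_klEng8Q8 :
    ∀ (P : SplitConsts) (R : RenConsts) (c : ℝ), P.WF → R.WF2 → 0 < c → c ≤ klEngC₃6 P R →
      ∀ μ ∈ klWindowC, ∀ U : ℝ, 0 < U → U ≤ klEngU₀9 P R c → ∀ β : ℝ, klBetaMin ≤ β → β ≤ Real.exp (c / U ^ 2) →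
        ∀ (L M : ℕ) [NeZero L] [NeZero M], klEngL₃ β U ≤ L → klEngM₃ β U L ≤ M →
          FrameOK R U (nScales β) μ (klFlowFrameU L M β U μ 0) →
            KernelNormsV4 L M P (klEngQ8 P R) β U μ (klFlowFrameU L M β U μ 0) 0 ∧
              PairLadderStepAtV17F2 L M klEngGeo8 P (klEngQ8 P R) β U μ 0 ∧
                QuarticValueUVAtV17F L M klEngGeo8 P (klEngQ8 P R) β U μ 0 ∧
                  EngineFirstMoments L M klEngGeo8 P (klEngQ8 P R) β U μ (klFlowFrameU L M β U μ 0) 0 ∧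
                    IsoTupleL1AtV17F L M klEngGeo8 P β U μ 0 :=
  fun P R c hP hR hc hc₆ μ hμ U hU hU₉ β hβ hβc L M _ _ hL hM hK =>
    scaleZeroConjV17F2_klEng8Q8_of_klEng7Q7 hP (stub_engine_scale0_klEng7Q7U9 P R c hP hR hc hc₆ μ hμ U hU hU₉ β hβ hβc L M hL hM hK)

/-- **STUB (a) `stub_engine_scale0` OF THE 20437 ENGINE-FLOW SKELETON AT THE v2 TOKEN SET {#13, #14, #15, #16} — PROVED** (the predicted v2 text:
the v1 registered bytes with `klEngQ7 ↦ klEngQ8`, `klEngU₀9 ↦ klEngU₀10`, `klEngGeo7 ↦ klEngGeo8`, `klEngL₃ β U ↦ klEngL₄ P R β U`): for every `P R c`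
with `P.WF`, `R.WF2`, `0 < c ≤ klEngC₃6 P R`, `μ ∈ klWindowC`, `0 < U ≤ klEngU₀10 P R c`, `klBetaMin ≤ β ≤ e^{c/U²}`, volumes above
`klEngL₄ P R β U` / `klEngM₃ β U L`, and the bare flow frame `K₀` admissible: (E1-v4)₀ ∧ (E2-F2)₀ ∧ (E2′-F UV)₀ ∧ (E4)₀ ∧ (E5-F)₀ at `(klEngGeo8, klEngQ8 P R)`. -/
theorem stub_engine_scale0_klEng8Q8U10L4 :
    ∀ (P : SplitConsts) (R : RenConsts) (c : ℝ), P.WF → R.WF2 → 0 < c → c ≤ klEngC₃6 P R →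
      ∀ μ ∈ klWindowC, ∀ U : ℝ, 0 < U → U ≤ klEngU₀10 P R c → ∀ β : ℝ, klBetaMin ≤ β → β ≤ Real.exp (c / U ^ 2) →
        ∀ (L M : ℕ) [NeZero L] [NeZero M], klEngL₄ P R β U ≤ L → klEngM₃ β U L ≤ M →
          FrameOK R U (nScales β) μ (klFlowFrameU L M β U μ 0) →
            KernelNormsV4 L M P (klEngQ8 P R) β U μ (klFlowFrameU L M β U μ 0) 0 ∧
              PairLadderStepAtV17F2 L M klEngGeo8 P (klEngQ8 P R) β U μ 0 ∧
                QuarticValueUVAtV17F L M klEngGeo8 P (klEngQ8 P R) β U μ 0 ∧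
                  EngineFirstMoments L M klEngGeo8 P (klEngQ8 P R) β U μ (klFlowFrameU L M β U μ 0) 0 ∧
                    IsoTupleL1AtV17F L M klEngGeo8 P β U μ 0 :=
  fun P R c hP hR hc hc₆ μ hμ U hU hU₁₀ β hβ hβc L M _ _ hL hM hK =>
    stub_engine_scale0_klEng8Q8 P R c hP hR hc hc₆ μ hμ U hU (hU₁₀.trans (klEngU₀10_le_klEngU₀9 P R c)) β hβ hβc L M
      (klEngL₃_le_of_klEngL₄_le hL) hM hK

end Summit.HubbardSuperconductivity.HubbardSuperconductivity.Theorems.EngineV8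

end
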